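import Summits.Ventures.PercRepro.C025ProfilePLDClosureParallel

/-!
# THE RANK PROFILE OF A DIRECT SUM IS THE CONVOLUTION OF THE PROFILES (night-3 g29)

`proofs/NIGHT3-G29-PARALLEL.md` §4 (VIII).  For finite matroids `M₁`, `M₂` with disjoint ground sets and any
`F : ℕ → ℕ → ℕ`, `Σ_{I ⊆ E₁ ∪ E₂} F (ρ I) (ρ (E ∖ I)) = Σ_{I₁ ⊆ E₁} Σ_{I₂ ⊆ E₂} F (ρ₁ I₁ + ρ₂ I₂) (ρ₁ (E₁ ∖ I₁) + ρ₂ (E₂ ∖ I₂))`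
(`sum_powerset_disjointSum`): every statement about the pairs `(rank, corank)` of a direct sum — PER-LAYER DOMINANCE in
particular — is a statement about the convolution of the two profiles, which is how the closure theorems are transferred
from families of pairs to matroids (`C025ProfilePLDClosureParallel` did it for a parallel-classes summand; this is the
general form the successor's closure under rank-`≥ 2` uniform flats needs, together with `PLDClosure.sum_complement`).
No `def`, no `instance`, no notation.  Axioms: standard.
-/

open scoped Matroid

namespace PercRepro

open Finset ThmH

namespace PLDClosure

variable {α : Type} [DecidableEq α]

omit [DecidableEq α] in
/-- The direct sum of two finite matroids is finite (a theorem, not an instance). -/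
theorem disjointSum_finite' (M₁ M₂ : Matroid α) [M₁.Finite] [M₂.Finite] (h : Disjoint M₁.E M₂.E) :
    (M₁.disjointSum M₂ h).Finite :=
  ⟨by rw [Matroid.disjointSum_ground_eq]; exact M₁.ground_finite.union M₂.ground_finite⟩

/-- The ground finset of a direct sum. -/
theorem gr_disjointSum (M₁ M₂ : Matroid α) [M₁.Finite] [M₂.Finite] (h : Disjoint M₁.E M₂.E) :
    haveI := disjointSum_finite' M₁ M₂ h
    gr (M₁.disjointSum M₂ h) = gr M₁ ∪ gr M₂ := by
  haveI := disjointSum_finite' M₁ M₂ h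
  apply Finset.coe_injective
  rw [coe_gr, Matroid.disjointSum_ground_eq, coe_union, coe_gr, coe_gr]

/-- The rank of a finset in a direct sum, in `ℕ`: `ρ₁(X ∩ E₁) + ρ₂(X ∩ E₂)`. -/
theorem toNat_eRk_disjointSum (M₁ M₂ : Matroid α) [M₁.Finite] [M₂.Finite] (h : Disjoint M₁.E M₂.E)
    (X : Finset α) :
    ((M₁.disjointSum M₂ h).eRk (X : Set α)).toNat =
      (M₁.eRk ((X ∩ gr M₁ : Finset α) : Set α)).toNat + (M₂.eRk ((X ∩ gr M₂ : Finset α) : Set α)).toNat := by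
  rw [SecondRow.eRk_disjointSum, ← coe_gr M₁, ← coe_gr M₂, ← coe_inter, ← coe_inter]
  obtain ⟨a, ha⟩ : ∃ a : ℕ, M₁.eRk ((X ∩ gr M₁ : Finset α) : Set α) = a :=
    ⟨_, (ENat.coe_toNat (eRk_ne_top' M₁ _)).symm⟩
  obtain ⟨b, hb⟩ : ∃ b : ℕ, M₂.eRk ((X ∩ gr M₂ : Finset α) : Set α) = b :=
    ⟨_, (ENat.coe_toNat (eRk_ne_top' M₂ _)).symm⟩
  rw [ha, hb, ← Nat.cast_add, ENat.toNat_coe, ENat.toNat_coe, ENat.toNat_coe]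

/-- THE PROFILE OF A DIRECT SUM IS THE CONVOLUTION OF THE PROFILES: for every `F`,
`Σ_{I ⊆ E₁ ∪ E₂} F (ρ I) (ρ (E ∖ I)) = Σ_{I₁ ⊆ E₁} Σ_{I₂ ⊆ E₂} F (ρ₁ I₁ + ρ₂ I₂) (ρ₁ (E₁ ∖ I₁) + ρ₂ (E₂ ∖ I₂))`. -/
theorem sum_powerset_disjointSum (M₁ M₂ : Matroid α) [M₁.Finite] [M₂.Finite] (h : Disjoint M₁.E M₂.E)
    (F : ℕ → ℕ → ℕ) :
    haveI := disjointSum_finite' M₁ M₂ h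
    ∑ I ∈ (gr (M₁.disjointSum M₂ h)).powerset,
        F ((M₁.disjointSum M₂ h).eRk (I : Set α)).toNat
          ((M₁.disjointSum M₂ h).eRk ((gr (M₁.disjointSum M₂ h) \ I : Finset α) : Set α)).toNat =
      ∑ I₁ ∈ (gr M₁).powerset, ∑ I₂ ∈ (gr M₂).powerset,
        F ((M₁.eRk (I₁ : Set α)).toNat + (M₂.eRk (I₂ : Set α)).toNat)
          ((M₁.eRk ((gr M₁ \ I₁ : Finset α) : Set α)).toNat + (M₂.eRk ((gr M₂ \ I₂ : Finset α) : Set α)).toNat) := by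
  haveI := disjointSum_finite' M₁ M₂ h
  have hdisj : Disjoint (gr M₁) (gr M₂) := by rw [← Finset.disjoint_coe, coe_gr, coe_gr]; exact h
  rw [gr_disjointSum, sum_powerset_union _ _ hdisj]
  refine Finset.sum_congr rfl fun I₁ hI₁ => Finset.sum_congr rfl fun I₂ hI₂ => ?_
  rw [mem_powerset] at hI₁ hI₂
  have e1 : (I₁ ∪ I₂) ∩ gr M₁ = I₁ := by
    have : I₂ ∩ gr M₁ = ∅ := Finset.disjoint_iff_inter_eq_empty.1 (hdisj.mono_right hI₂).symm
    rw [union_inter_distrib_right, inter_eq_left.2 hI₁, this, union_empty]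
  have e2 : (I₁ ∪ I₂) ∩ gr M₂ = I₂ := by
    have : I₁ ∩ gr M₂ = ∅ := Finset.disjoint_iff_inter_eq_empty.1 (hdisj.mono_left hI₁)
    rw [union_inter_distrib_right, inter_eq_left.2 hI₂, this, empty_union]
  have e3 : ((gr M₁ ∪ gr M₂) \ (I₁ ∪ I₂)) ∩ gr M₁ = gr M₁ \ I₁ := by
    ext e
    simp only [mem_inter, mem_sdiff, mem_union, not_or]
    constructor
    · rintro ⟨⟨-, h1, -⟩, h3⟩; exact ⟨h3, h1⟩
    · rintro ⟨h1, h2⟩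
      exact ⟨⟨Or.inl h1, h2, fun h3 => (disjoint_left.1 hdisj h1) (hI₂ h3)⟩, h1⟩
  have e4 : ((gr M₁ ∪ gr M₂) \ (I₁ ∪ I₂)) ∩ gr M₂ = gr M₂ \ I₂ := by
    ext e
    simp only [mem_inter, mem_sdiff, mem_union, not_or]
    constructor
    · rintro ⟨⟨-, -, h2⟩, h3⟩; exact ⟨h3, h2⟩
    · rintro ⟨h1, h2⟩
      exact ⟨⟨Or.inr h1, fun h3 => (disjoint_left.1 hdisj.symm h1) (hI₁ h3), h2⟩, h1⟩
  rw [toNat_eRk_disjointSum M₁ M₂ h (I₁ ∪ I₂), toNat_eRk_disjointSum M₁ M₂ h, e1, e2, e3, e4]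

end PLDClosure

end PercRepro
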